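import Summits.Schanuel.Schanuel.Theorems.ZilberEacAxisLogLimits
import HarnessLib

/-!
# A ZERO fibre polynomial (`y₁ = x₁`): exponential points by the FIXED-POINT-FIBRE regime

Zilber's Exponential-Algebraic Closedness, case ladder (host summit Schanuel, cell `pub-schanuel`,
seat 2, gen 15; HANDOFF O60′ (ii′)).  Family
`W = {x₂ = r₀x₀ + r₁x₁ + c, y₀ = x₀ + y₂F₀(y₂), y₁ = x₁} ⊆ ℂ³ × ℂ³` (`F₁ = 0`,
`F₀ = Σ_{i<e₀}A_{0,i}uⁱ` arbitrary).  The second fibre equation `e^{x₁} = x₁` no longer involves the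
base: `x₁` is a FIXED POINT of `exp`, `x₁ = ξ_k = Log(2πik) + 2πik + v_k` (`v_k → 0`,
`exists_expFixedPoints`), for a FREE label `k ≍ m^β`; it enters the first fibre only through the
scale `e^{r₁ξ_k} ≍ (2πk)^{r₁}` of `y₂ = e^{r₀x₀ + r₁ξ_k + c}`.  The first fibre is slow:
`x₀ = Log(2πim) + 2πim + u₀`, `y₂ = Y_me^{r₀u₀}`, `|Y_m| ≍ m^{r₀}k^{r₁} ≍ m^{r₀ + βr₁}`, and the
rescaled equation `e^{u₀} − 1 − ν₁ − μ₁u₀ − θΣA_{0,i}σ^{e₀−1−i}e^{(i+1)r₀u₀} = 0` (`θ = Y^{e₀}/(2πim)`,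
`σ = Y⁻¹`) has all parameters `→ 0` exactly when `0 < r₀ + βr₁` and `e₀(r₀ + βr₁) < 1`.

* `exists_expFixedPoints` — fixed points of `exp`: `ξ_m = Log(2πim) + 2πim + v_m`, `v_m → 0`.
* `tendsto_exp_affine_log_of_abs_le` — the decay lemma with a bounded perturbation.
* **`exists_solutions_fixedFibre`** — the solutions, with `u → 0`, the label `k_m ∈ [m^β, m^β+1]`,
  and eventually `e^{x₀} = x₀ + y₂Σ_{i<e₀}A_{0,i}y₂ⁱ` (`y₂ = e^{r₀x₀ + r₁x₁ + c}`), `e^{x₁} = x₁`.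

HONEST FRAMING: explicit members of an OPEN cell (`ECCell 3 2`); NOT Schanuel's conjecture;
EAC ⇏ SC.
-/

noncomputable section

open Complex Filter Topology

set_option linter.dupNamespace false

namespace Summit.Schanuel.Schanuel.Theorems

section FixedPoints

/-- **Fixed points of the exponential near the lattice**: `ξ_m = Log(2πim) + 2πim + v_m` with
`v_m → 0` and `e^{ξ_m} = ξ_m` for all large `m` (the equation `e^{v} = 1 + (Log(2πim) + v)/(2πim)`
by the implicit function theorem). [folklore] -/
theorem exists_expFixedPoints : ∃ v : ℕ → ℂ, Tendsto v atTop (𝓝 0) ∧ ∀ᶠ m : ℕ in atTop,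
    exp (Complex.log (2 * Real.pi * I * (m : ℂ)) + 2 * Real.pi * I * (m : ℂ) + v m) =
      Complex.log (2 * Real.pi * I * (m : ℂ)) + 2 * Real.pi * I * (m : ℂ) + v m := by
  have hprt := tendsto_param_nu₁.prodMk_nhds tendsto_param_mu₁
  rw [show (((0 : ℂ), (0 : ℂ)) : ℂ × ℂ) = 0 from rfl] at hprt
  set f : (ℂ × ℂ) × ℂ → ℂ := fun w => exp w.2 - 1 - w.1.1 - w.1.2 * w.2 with hf
  have hfC : ContDiff ℂ 1 f := by rw [hf]; fun_prop
  have hfq : f (0, 0) = 0 := by simp [hf]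
  have hLderiv : HasFDerivAt (fun v : ℂ => f (0, v)) (ContinuousLinearMap.id ℂ ℂ) 0 := by
    have eqf : (fun v : ℂ => f (0, v)) = fun v => exp v - 1 := by funext v; simp [hf]
    rw [eqf]
    refine ((hasFDerivAt_id (𝕜 := ℂ) (0 : ℂ)).cexp.sub_const 1).congr_fderiv ?_
    ext; simp
  have hinj : Function.Injective (ContinuousLinearMap.id ℂ ℂ) := fun a b h => by simpa using h
  obtain ⟨ψ, hψsol, hψlim⟩ := exists_implicit_of_injective_partial hfC hfq hLderiv hinj
  set pr : ℕ → ℂ × ℂ := fun m => ((2 * Real.pi * I * (m : ℂ))⁻¹ * Complex.log (2 * Real.pi * I * (m : ℂ)),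
    (2 * Real.pi * I * (m : ℂ))⁻¹) with hpr
  have hprt' : Tendsto pr atTop (𝓝 0) := hprt
  refine ⟨fun m => ψ (pr m), hψlim.comp hprt', ?_⟩
  filter_upwards [hprt'.eventually hψsol, eventually_ge_atTop 1] with m hm hm1
  have h2πim : (2 * Real.pi * I * (m : ℂ)) ≠ 0 :=
    mul_ne_zero Complex.two_pi_I_ne_zero (by exact_mod_cast (show m ≠ 0 by omega))
  have hμm : (2 * Real.pi * I * (m : ℂ)) * (2 * Real.pi * I * (m : ℂ))⁻¹ = 1 := mul_inv_cancel₀ h2πim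
  have heq : exp (ψ (pr m)) - 1 - (2 * Real.pi * I * (m : ℂ))⁻¹ * Complex.log (2 * Real.pi * I * (m : ℂ)) -
      (2 * Real.pi * I * (m : ℂ))⁻¹ * ψ (pr m) = 0 := by simpa [hf, hpr] using hm
  rw [Complex.exp_add, Complex.exp_add, Complex.exp_log h2πim,
    show 2 * Real.pi * I * (m : ℂ) = ((m : ℤ) : ℂ) * (2 * Real.pi * I) by push_cast; ring,
    Complex.exp_int_mul_two_pi_mul_I, mul_one]
  rw [show ((m : ℤ) : ℂ) * (2 * Real.pi * I) = 2 * Real.pi * I * (m : ℂ) by push_cast; ring]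
  linear_combination (2 * Real.pi * I * (m : ℂ)) * heq +
    (Complex.log (2 * Real.pi * I * (m : ℂ)) + ψ (pr m)) * hμm

/-- `‖Log(2πim) + 2πim + v‖`-type facts are in `ZilberEacCancellingFibreLimits`; here: the real
part of a fixed point, `Re ξ_m = log(2πm) + Re v_m`. [folklore] -/
theorem re_expFixedPoint (m : ℕ) (v : ℂ) :
    (Complex.log (2 * Real.pi * I * (m : ℂ)) + 2 * Real.pi * I * (m : ℂ) + v).re =
      Real.log (2 * Real.pi * m) + v.re := by
  rw [Complex.add_re, Complex.add_re, re_log_two_pi_I_mul_natCast,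
    show (2 * Real.pi * I * (m : ℂ)) = 2 * Real.pi * I * ((m : ℝ) : ℂ) by norm_cast,
    re_two_pi_I_mul_ofReal, add_zero]

end FixedPoints

section FixedFibre

variable {β : ℝ} {K : ℕ → ℝ}

/-- **Decay with a bounded perturbation**: `e^{a_m + b log K_m + c log m} → 0` when `|a_m| ≤ A`
eventually and `bβ + c < 0`. [folklore] -/
theorem tendsto_exp_affine_log_of_abs_le (hβ : 0 < β)
    (hK : ∀ m : ℕ, (m : ℝ) ^ β ≤ K m ∧ K m ≤ (m : ℝ) ^ β + 1) {a : ℕ → ℝ} {A : ℝ}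
    (ha : ∀ᶠ m in atTop, |a m| ≤ A) (b c : ℝ) (h : b * β + c < 0) :
    Tendsto (fun m : ℕ => Real.exp (a m + b * Real.log (K m) + c * Real.log m)) atTop (𝓝 0) := by
  have hmaj := tendsto_exp_affine_log hβ hK A b c h
  refine squeeze_zero' (Eventually.of_forall fun m => (Real.exp_pos _).le) ?_ hmaj
  filter_upwards [ha] with m hm
  exact Real.exp_le_exp.2 (by linarith [le_abs_self (a m)])

/-- **THEOREM (exponential points with a zero fibre polynomial, fixed-point-fibre regime).**
See the module docstring. (new) [cite: MantovaMasser2023, §1 p.5 (the open case dim π(V) = 2 in ℂ³×ℂˣ³)] -/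
theorem exists_solutions_fixedFibre (e₀ : ℕ) (A₀ : ℕ → ℂ) (r₀ r₁ : ℝ) (c : ℂ) (hβ : 0 < β)
    (hlo : 0 < r₀ + β * r₁) (hhi : (r₀ + β * r₁) * e₀ < 1) :
    ∃ (k : ℕ → ℕ) (x : ℕ → Fin 2 → ℂ) (u : ℕ → ℂ × ℂ),
      (∀ m : ℕ, (m : ℝ) ^ β ≤ (k m : ℝ) ∧ (k m : ℝ) ≤ (m : ℝ) ^ β + 1) ∧
      Tendsto u atTop (𝓝 0) ∧
      (∀ m, x m 0 = Complex.log (2 * Real.pi * I * (m : ℂ)) + 2 * Real.pi * I * (m : ℂ) + (u m).1) ∧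
      (∀ m, x m 1 = Complex.log (2 * Real.pi * I * (k m : ℂ)) + 2 * Real.pi * I * (k m : ℂ) + (u m).2) ∧
      ∀ᶠ m in atTop,
        exp (x m 0) = x m 0 + exp (∑ i, ((![r₀, r₁] : Fin 2 → ℝ) i : ℂ) * x m i + c) *
            ∑ i ∈ Finset.range e₀, A₀ i *
              (exp (∑ i, ((![r₀, r₁] : Fin 2 → ℝ) i : ℂ) * x m i + c)) ^ i ∧
        exp (x m 1) = x m 1 := by
  have h2πI : (2 * Real.pi * I : ℂ) ≠ 0 := Complex.two_pi_I_ne_zero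
  -- the free second label `k ≍ m^β` and the fixed points `ξ_k`
  obtain ⟨k, hkdef⟩ : ∃ k : ℕ → ℕ, k = fun m : ℕ => ⌈(m : ℝ) ^ β⌉₊ := ⟨_, rfl⟩
  have hk : ∀ m : ℕ, (m : ℝ) ^ β ≤ (k m : ℝ) ∧ (k m : ℝ) ≤ (m : ℝ) ^ β + 1 := by
    intro m; rw [hkdef]; exact ⟨Nat.le_ceil _, (Nat.ceil_lt_add_one (by positivity)).le⟩
  obtain ⟨K, hKdef⟩ : ∃ K : ℕ → ℝ, K = fun m => (k m : ℝ) := ⟨_, rfl⟩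
  have hK : ∀ m : ℕ, (m : ℝ) ^ β ≤ K m ∧ K m ≤ (m : ℝ) ^ β + 1 := by intro m; rw [hKdef]; exact hk m
  have hktop : Tendsto k atTop atTop := by
    refine (tendsto_natCast_atTop_iff (R := ℝ)).1 ?_
    exact tendsto_atTop_mono (fun m => (hk m).1) ((tendsto_rpow_atTop hβ).comp tendsto_natCast_atTop_atTop)
  obtain ⟨v, hv, hvfix⟩ := exists_expFixedPoints
  have hvk : Tendsto (fun m => v (k m)) atTop (𝓝 0) := hv.comp hktop
  have hfixk : ∀ᶠ m in atTop, exp (Complex.log (2 * Real.pi * I * (k m : ℂ)) + 2 * Real.pi * I * (k m : ℂ) +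
      v (k m)) = Complex.log (2 * Real.pi * I * (k m : ℂ)) + 2 * Real.pi * I * (k m : ℂ) + v (k m) :=
    hktop.eventually hvfix
  -- the scale `Y_m = e^{r₀(Log 2πim + 2πim) + r₁ξ_{k_m} + c}` and the parameters
  set ξ : ℕ → ℂ := fun m => Complex.log (2 * Real.pi * I * (k m : ℂ)) + 2 * Real.pi * I * (k m : ℂ) +
    v (k m) with hξ
  set Y : ℕ → ℂ := fun m => exp ((r₀ : ℂ) * (Complex.log (2 * Real.pi * I * (m : ℂ)) +
    2 * Real.pi * I * (m : ℂ)) + (r₁ : ℂ) * ξ m + c) with hY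
  have hnormY : ∀ m : ℕ, 1 ≤ m → ‖Y m‖ = Real.exp ((r₀ * Real.log (2 * Real.pi) + c.re +
      r₁ * Real.log (2 * Real.pi) + r₁ * (v (k m)).re) + r₁ * Real.log (K m) + r₀ * Real.log m) := by
    intro m hm
    have hmpos : (0 : ℝ) < m := by exact_mod_cast hm
    have hk1 : (0 : ℝ) < k m := by
      have := one_le_of_rpow_le hβ (fun m => (hk m).1) hm
      linarith
    rw [hY]
    simp only
    rw [Complex.norm_exp, Complex.add_re, Complex.add_re, Complex.re_ofReal_mul, Complex.re_ofReal_mul,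
      Complex.add_re, re_log_two_pi_I_mul_natCast, hξ]
    simp only
    rw [re_expFixedPoint, show (2 * Real.pi * I * (m : ℂ)) = 2 * Real.pi * I * ((m : ℝ) : ℂ) by norm_cast,
      re_two_pi_I_mul_ofReal, add_zero, Real.log_mul (by positivity) hmpos.ne',
      Real.log_mul (by positivity) hk1.ne', hKdef]
    congr 1
    ring
  have hvre : ∀ᶠ m in atTop, |(r₀ * Real.log (2 * Real.pi) + c.re + r₁ * Real.log (2 * Real.pi) +
      r₁ * (v (k m)).re)| ≤ |r₀ * Real.log (2 * Real.pi) + c.re + r₁ * Real.log (2 * Real.pi)| + |r₁| := by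
    have h1 := (tendsto_zero_iff_norm_tendsto_zero.1 hvk).eventually (ge_mem_nhds zero_lt_one)
    filter_upwards [h1] with m hm
    have : |(v (k m)).re| ≤ 1 := (Complex.abs_re_le_norm _).trans hm
    calc _ ≤ |r₀ * Real.log (2 * Real.pi) + c.re + r₁ * Real.log (2 * Real.pi)| + |r₁ * (v (k m)).re| :=
          abs_add_le _ _
      _ ≤ _ := by rw [abs_mul]; nlinarith [abs_nonneg r₁]
  -- `σ = Y⁻¹ → 0` and `θ = Y^{e₀}/(2πim) → 0`
  have hσ : Tendsto (fun m => (Y m)⁻¹) atTop (𝓝 0) := by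
    rw [tendsto_zero_iff_norm_tendsto_zero]
    have h := tendsto_exp_affine_log_of_abs_le hβ hK (A := |r₀ * Real.log (2 * Real.pi) + c.re +
      r₁ * Real.log (2 * Real.pi)| + |r₁|) (a := fun m => -(r₀ * Real.log (2 * Real.pi) + c.re +
      r₁ * Real.log (2 * Real.pi) + r₁ * (v (k m)).re)) (by simpa only [abs_neg] using hvre)
      (-r₁) (-r₀) (by linarith)
    refine h.congr' ?_
    filter_upwards [eventually_ge_atTop 1] with m hm
    rw [norm_inv, hnormY m hm, ← Real.exp_neg]
    congr 1; ring
  have hθ : Tendsto (fun m : ℕ => (2 * Real.pi * I * (m : ℂ))⁻¹ * Y m ^ e₀) atTop (𝓝 0) := by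
    rw [tendsto_zero_iff_norm_tendsto_zero]
    have h := tendsto_exp_affine_log_of_abs_le hβ hK
      (A := (e₀ : ℝ) * (|r₀ * Real.log (2 * Real.pi) + c.re + r₁ * Real.log (2 * Real.pi)| + |r₁|) +
        |Real.log (2 * Real.pi)|)
      (a := fun m => (e₀ : ℝ) * (r₀ * Real.log (2 * Real.pi) + c.re + r₁ * Real.log (2 * Real.pi) +
        r₁ * (v (k m)).re) - Real.log (2 * Real.pi)) ?_ ((e₀ : ℝ) * r₁) ((e₀ : ℝ) * r₀ - 1) (by nlinarith)
    · refine h.congr' ?_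
      filter_upwards [eventually_ge_atTop 1] with m hm
      have hmpos : (0 : ℝ) < m := by exact_mod_cast hm
      rw [norm_mul, norm_pow, hnormY m hm, ← Real.exp_nat_mul, norm_inv, norm_two_pi_I_mul_natCast,
        ← Real.exp_log (show (0 : ℝ) < 2 * Real.pi * m by positivity), ← Real.exp_neg, ← Real.exp_add,
        Real.log_mul (by positivity) hmpos.ne']
      congr 1; ring
    · filter_upwards [hvre] with m hm
      calc _ ≤ |(e₀ : ℝ) * (r₀ * Real.log (2 * Real.pi) + c.re + r₁ * Real.log (2 * Real.pi) +
            r₁ * (v (k m)).re)| + |Real.log (2 * Real.pi)| := abs_sub _ _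
        _ ≤ _ := by rw [abs_mul, abs_of_nonneg (Nat.cast_nonneg e₀)]; gcongr
  have hprt := tendsto_param_nu₁.prodMk_nhds (tendsto_param_mu₁.prodMk_nhds (hθ.prodMk_nhds hσ))
  rw [show (((0 : ℂ), (0 : ℂ), (0 : ℂ), (0 : ℂ)) : ℂ × ℂ × ℂ × ℂ) = 0 from rfl] at hprt
  -- the rescaled first fibre equation and the IFT
  set f : (ℂ × ℂ × ℂ × ℂ) × ℂ → ℂ := fun w =>
    exp w.2 - 1 - w.1.1 - w.1.2.1 * w.2 -
      w.1.2.2.1 * ∑ i ∈ Finset.range e₀, A₀ i * w.1.2.2.2 ^ (e₀ - 1 - i) *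
        exp ((((i : ℕ) : ℂ) + 1) * ((r₀ : ℂ) * w.2)) with hf
  have hfC : ContDiff ℂ 1 f := by rw [hf]; fun_prop
  have eqf : (fun q' : ℂ => f (0, q')) = fun q' => exp q' - 1 := by
    funext q'; simp [hf]
  have hfq : f (0, 0) = 0 := by have := congrFun eqf 0; rw [this]; simp
  have hLderiv : HasFDerivAt (fun q' : ℂ => f (0, q')) (ContinuousLinearMap.id ℂ ℂ) 0 := by
    rw [eqf]
    refine ((hasFDerivAt_id (𝕜 := ℂ) (0 : ℂ)).cexp.sub_const 1).congr_fderiv ?_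
    ext; simp
  have hinj : Function.Injective (ContinuousLinearMap.id ℂ ℂ) := fun a b h => by simpa using h
  obtain ⟨ψ, hψsol, hψlim⟩ := exists_implicit_of_injective_partial hfC hfq hLderiv hinj
  set pr : ℕ → ℂ × ℂ × ℂ × ℂ := fun m =>
    ((2 * Real.pi * I * (m : ℂ))⁻¹ * Complex.log (2 * Real.pi * I * (m : ℂ)), (2 * Real.pi * I * (m : ℂ))⁻¹,
      (2 * Real.pi * I * (m : ℂ))⁻¹ * Y m ^ e₀, (Y m)⁻¹) with hpr
  have hprt' : Tendsto pr atTop (𝓝 0) := hprt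
  have hsol : ∀ᶠ m in atTop, f (pr m, ψ (pr m)) = 0 := hprt'.eventually hψsol
  set x : ℕ → Fin 2 → ℂ := fun m =>
    ![Complex.log (2 * Real.pi * I * (m : ℂ)) + 2 * Real.pi * I * (m : ℂ) + ψ (pr m), ξ m] with hx
  refine ⟨k, x, fun m => (ψ (pr m), v (k m)), hk, (hψlim.comp hprt').prodMk_nhds hvk,
    fun m => ?_, fun m => ?_, ?_⟩
  · simp only [hx, Matrix.cons_val_zero]
  · simp only [hx, Matrix.cons_val_one, Matrix.cons_val_zero, hξ]
  filter_upwards [hsol, hfixk, eventually_ge_atTop 1] with m hm hmfix hm1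
  have hmC : (m : ℂ) ≠ 0 := by exact_mod_cast (show m ≠ 0 by omega)
  have h2πim : (2 * Real.pi * I * (m : ℂ)) ≠ 0 := mul_ne_zero h2πI hmC
  have hY0 : Y m ≠ 0 := Complex.exp_ne_zero _
  obtain ⟨Λ₀, hΛ₀⟩ : ∃ Λ : ℂ, Complex.log (2 * Real.pi * I * (m : ℂ)) = Λ := ⟨_, rfl⟩
  obtain ⟨Yv, hYv⟩ : ∃ Yv : ℂ, Y m = Yv := ⟨_, rfl⟩
  obtain ⟨u₀, hu₀⟩ : ∃ u₀ : ℂ, ψ (pr m) = u₀ := ⟨_, rfl⟩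
  obtain ⟨σ, hσ'⟩ : ∃ σ : ℂ, Yv⁻¹ = σ := ⟨_, rfl⟩
  have hYv0 : Yv ≠ 0 := by rw [← hYv]; exact hY0
  have hYσ : Yv * σ = 1 := by rw [← hσ']; exact mul_inv_cancel₀ hYv0
  have hx0 : x m 0 = Λ₀ + 2 * Real.pi * I * (m : ℂ) + u₀ := by
    simp only [hx, Matrix.cons_val_zero]; rw [hΛ₀, hu₀]
  have hx1 : x m 1 = ξ m := by simp only [hx, Matrix.cons_val_one, Matrix.cons_val_zero]
  have hℓ : ∑ i, ((![r₀, r₁] : Fin 2 → ℝ) i : ℂ) * x m i + c =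
      (r₀ : ℂ) * (Λ₀ + 2 * Real.pi * I * (m : ℂ) + u₀) + (r₁ : ℂ) * ξ m + c := by
    rw [Fin.sum_univ_two]
    simp only [Matrix.cons_val_zero, Matrix.cons_val_one, hx0, hx1]
  have hexpℓ : exp (∑ i, ((![r₀, r₁] : Fin 2 → ℝ) i : ℂ) * x m i + c) = Yv * exp ((r₀ : ℂ) * u₀) := by
    rw [hℓ, ← hYv, hY]
    simp only
    rw [← Complex.exp_add, hΛ₀]
    congr 1; ring
  have hEpow : ∀ i : ℕ, (Yv * exp ((r₀ : ℂ) * u₀)) ^ (i + 1) =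
      Yv ^ (i + 1) * exp ((((i : ℕ) : ℂ) + 1) * ((r₀ : ℂ) * u₀)) := by
    intro i; rw [mul_pow]; congr 1; rw [← Complex.exp_nat_mul, Nat.cast_succ]
  obtain ⟨R₀, hR₀⟩ : ∃ R : ℂ, (∑ i ∈ Finset.range e₀, A₀ i * σ ^ (e₀ - 1 - i) *
    exp ((((i : ℕ) : ℂ) + 1) * ((r₀ : ℂ) * u₀))) = R := ⟨_, rfl⟩
  have hW0 : Yv * exp ((r₀ : ℂ) * u₀) * ∑ i ∈ Finset.range e₀, A₀ i * (Yv * exp ((r₀ : ℂ) * u₀)) ^ i =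
      Yv ^ e₀ * R₀ := by
    rw [← hR₀, Finset.mul_sum, Finset.mul_sum]
    refine Finset.sum_congr rfl fun i hi => ?_
    have hi' : i < e₀ := Finset.mem_range.1 hi
    rw [show Yv * exp ((r₀ : ℂ) * u₀) * (A₀ i * (Yv * exp ((r₀ : ℂ) * u₀)) ^ i) =
      A₀ i * (Yv * exp ((r₀ : ℂ) * u₀)) ^ (i + 1) by ring, hEpow i, pow_succ_eq_pow_mul_inv_pow hYσ hi']
    ring
  have hp1 : (pr m).1 = (2 * Real.pi * I * (m : ℂ))⁻¹ * Λ₀ := by simp only [hpr]; rw [hΛ₀]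
  have hp2 : (pr m).2.1 = (2 * Real.pi * I * (m : ℂ))⁻¹ := by simp only [hpr]
  have hp3 : (pr m).2.2.1 = (2 * Real.pi * I * (m : ℂ))⁻¹ * Yv ^ e₀ := by simp only [hpr]; rw [hYv]
  have hp4 : (pr m).2.2.2 = σ := by simp only [hpr]; rw [hYv, hσ']
  have heq := hm
  simp only [hf] at heq
  rw [hp1, hp2, hp3, hp4, hu₀, hR₀] at heq
  have hμm : (2 * Real.pi * I * (m : ℂ)) * (2 * Real.pi * I * (m : ℂ))⁻¹ = 1 := mul_inv_cancel₀ h2πim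
  have hex0 : exp (x m 0) = 2 * Real.pi * I * (m : ℂ) * exp u₀ := by
    rw [hx0, Complex.exp_add, Complex.exp_add, ← hΛ₀, Complex.exp_log h2πim,
      show 2 * Real.pi * I * (m : ℂ) = ((m : ℤ) : ℂ) * (2 * Real.pi * I) by push_cast; ring,
      Complex.exp_int_mul_two_pi_mul_I, mul_one]
  refine ⟨?_, by rw [hx1]; exact hmfix⟩
  rw [hexpℓ, hW0, hex0, hx0]
  linear_combination (2 * Real.pi * I * (m : ℂ)) * heq + (Λ₀ + u₀ + Yv ^ e₀ * R₀) * hμm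

end FixedFibre

end Summit.Schanuel.Schanuel.Theorems
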